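import Summits.RiemannHypothesis.RiemannHypothesis.Theorems.UniversalFactorNarrowKernelNoGoEnergyUpperAssembly
import Literature.NumberTheory.LFunctions.DobnerNewman

/-!
# RiemannHypothesis / UniversalFactor — `NarrowKernelNoGo`, stub K1b: the log-free energy upper bound
`∫_T^{2T+1} (I₁ w + I₀ w')² ≤ C T`

Route `RiemannHypothesis/UniversalFactor`, crux `NarrowKernelNoGo` (stmt-RiemannHypothesis-2576), line
`Sketch`, registered stub `UniversalFactor.stub_narrowEnergyUpper`. With `E(τ) = ‖γ(1/2+iτ)‖`
(`γ = xiGammaFactor`), `Z = hardyZ`, `w(t) = t^{-7/4} e^{πt/4}`, `w' = w(π/4 − 7/(4t))`,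
`I₀(t) = ∫ e^{-2a|u|} E(t+u) Z(t+u) du`, `I₁(t) = ∫ 2a sgn(u) e^{-2a|u|} E(t+u) Z(t+u) du` (`a > π/8`):
given the Stirling envelope (i) `E(τ) ≤ C₀(1+|τ|)^{7/4}e^{-π|τ|/4}` and (ii)
`E(t+u)w(t) = c₀e^{-πu/4} + O(e^{-πu/4}(1+|u|)/t)` (`|u| ≤ t/2`), there are `C, T₁` with
`∫_T^{2T+1} (I₁ w + I₀ w')² ≤ C T` for `T ≥ T₁` — NO `log T`.

Proof: `(I₁w + I₀w')² ≤ 2 (I₁w)² + 2 (I₀w)²` (`|π/4 − 7/(4t)| ≤ 1`), and each `J_k = I_k w` is handled by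
the abstract `UniversalFactor.narrowUpper_kernel_bound` (parts 1–6) with the two Lorentz kernels
`k₀ = e^{-2a|u|}` (`B = 1`) and `k₁ = 2a·sgn·e^{-2a|u|}` (`B = 2a`), whose profiles have the explicit
transforms `1/(2a+π/4−iω) ± 1/(2a−π/4+iω)`: `|ĝ|² ≤ G₀/(1+ω²)` and `ĝ` Lipschitz, so the filtered
coefficients `|ĝ(log(N/n))|²` sum to `O(1)` against `1/n` (the log-free harmonic sum of part 1).

References: Titchmarsh, *The Theory of the Riemann Zeta-Function* (1986), §7.2–7.4, §9.20;
Montgomery–Vaughan, *Hilbert's inequality* (1974).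
-/

noncomputable section

-- D-0017: `Summit.<S>.<S>.…` is the designed namespace of a single-problem summit.
set_option linter.dupNamespace false

namespace Summit.RiemannHypothesis.RiemannHypothesis.Theorems

open MeasureTheory Set Filter Complex intervalIntegral
open scoped Real Topology
open Literature.NumberTheory.LFunctions

/-! ## The transforms of the two kernels: size and Lipschitz bounds -/

/-- `‖1/(2a+π/4 − iω)‖² ≤ (1 + 1/c²)/(1+ω²)` and `‖1/(2a−π/4 + iω)‖² ≤ (1 + 1/c²)/(1+ω²)`,
`c = 2a − π/4 > 0`. [folklore] -/
theorem UniversalFactor.narrowUpper_fraction_sq_le {a : ℝ} (ha : π / 8 < a) (ω : ℝ) :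
    ‖(1 : ℂ) / (((2 * a + π / 4 : ℝ) : ℂ) - ω * I)‖ ^ 2 ≤ (1 + 1 / (2 * a - π / 4) ^ 2) / (1 + ω ^ 2) ∧
    ‖(1 : ℂ) / (((2 * a - π / 4 : ℝ) : ℂ) + ω * I)‖ ^ 2 ≤ (1 + 1 / (2 * a - π / 4) ^ 2) / (1 + ω ^ 2) := by
  have hc : 0 < 2 * a - π / 4 := by linarith
  have hπ := Real.pi_pos
  constructor
  · have h : ((2 * a + π / 4 : ℝ) : ℂ) - ω * I = ((2 * a + π / 4 : ℝ) : ℂ) + ((-ω : ℝ) : ℂ) * I := by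
      push_cast; ring
    rw [h]
    have := UniversalFactor.narrowUpper_norm_sq_inv_le (α := 2 * a + π / 4) (β := -ω) hc (by nlinarith)
    simpa only [neg_sq] using this
  · exact UniversalFactor.narrowUpper_norm_sq_inv_le hc le_rfl

/-- Lipschitz bounds of the two fractions in `ω`: both `≤ |ω − ω'|/c²`. [folklore] -/
theorem UniversalFactor.narrowUpper_fraction_lip {a : ℝ} (ha : π / 8 < a) (ω ω' : ℝ) :
    ‖(1 : ℂ) / (((2 * a + π / 4 : ℝ) : ℂ) - ω * I) - 1 / (((2 * a + π / 4 : ℝ) : ℂ) - ω' * I)‖ ≤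
      |ω - ω'| / (2 * a - π / 4) ^ 2 ∧
    ‖(1 : ℂ) / (((2 * a - π / 4 : ℝ) : ℂ) + ω * I) - 1 / (((2 * a - π / 4 : ℝ) : ℂ) + ω' * I)‖ ≤
      |ω - ω'| / (2 * a - π / 4) ^ 2 := by
  have hc : 0 < 2 * a - π / 4 := by linarith
  have hπ := Real.pi_pos
  have hp : 0 < 2 * a + π / 4 := by linarith
  constructor
  · have h : ∀ x : ℝ, ((2 * a + π / 4 : ℝ) : ℂ) - x * I = ((2 * a + π / 4 : ℝ) : ℂ) + ((-x : ℝ) : ℂ) * I := by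
      intro x; push_cast; ring
    rw [h ω, h ω']
    refine (UniversalFactor.narrowUpper_inv_sub_inv_le hp.ne' (-ω) (-ω')).trans ?_
    rw [show |(-ω) - (-ω')| = |ω - ω'| by rw [← abs_neg]; ring_nf]
    exact div_le_div_of_nonneg_left (abs_nonneg _) (by positivity) (by nlinarith)
  · exact UniversalFactor.narrowUpper_inv_sub_inv_le hc.ne' ω ω'

/-- `‖A + B‖² ≤ 2‖A‖² + 2‖B‖²` and `‖A − B‖² ≤ 2‖A‖² + 2‖B‖²`. [folklore] -/
theorem UniversalFactor.narrowUpper_norm_add_sq_le (A B : ℂ) :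
    ‖A + B‖ ^ 2 ≤ 2 * ‖A‖ ^ 2 + 2 * ‖B‖ ^ 2 ∧ ‖A - B‖ ^ 2 ≤ 2 * ‖A‖ ^ 2 + 2 * ‖B‖ ^ 2 := by
  have h1 := norm_add_le A B
  have h2 := norm_sub_le A B
  constructor
  · nlinarith [norm_nonneg (A + B), norm_nonneg A, norm_nonneg B, sq_nonneg (‖A‖ - ‖B‖)]
  · nlinarith [norm_nonneg (A - B), norm_nonneg A, norm_nonneg B, sq_nonneg (‖A‖ - ‖B‖)]

/-! ## The stub -/

/-- **Stub K1b (log-free energy, upper bound for the derivative)** of the line `Sketch` of the crux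
`NarrowKernelNoGo` (verbatim registered signature). For `a > π/8`, with
`I₀(t) = ∫ℝ e^{−2a|u|} E(t+u) Z(t+u) du`, `I₁(t) = ∫ℝ 2a·sgn(u) e^{−2a|u|} E(t+u) Z(t+u) du` and
`w(t) = t^{-7/4} e^{πt/4}`, `w' = w · (π/4 − 7/(4t))`: `∫_T^{2T+1} (I₁ w + I₀ w')² dt ≤ C T` for `T ≥ T₁`,
given the envelope facts (i)–(ii) for `E(τ) = ‖γ(1/2+iτ)‖`. [folklore] -/
theorem UniversalFactor.stub_narrowEnergyUpper :
    ((∃ C₀ : ℝ, ∀ τ : ℝ, ‖xiGammaFactor (1 / 2 + (τ : ℂ) * I)‖ ≤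
        C₀ * (1 + |τ|) ^ ((7 : ℝ) / 4) * Real.exp (-(π * |τ| / 4))) ∧
      (∃ c₀ C T₀ : ℝ, 0 < c₀ ∧ ∀ t : ℝ, T₀ ≤ t → ∀ u : ℝ, |u| ≤ t / 2 →
        |‖xiGammaFactor (1 / 2 + ((t + u : ℝ) : ℂ) * I)‖ * (t ^ (-(7 : ℝ) / 4) * Real.exp (π * t / 4)) -
            c₀ * Real.exp (-(π * u / 4))| ≤ C * Real.exp (-(π * u / 4)) * (1 + |u|) / t)) →
    ∀ a : ℝ, π / 8 < a → ∃ C T₁ : ℝ,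
    ∀ T : ℝ, T₁ ≤ T →
      ∫ t in T..(2 * T + 1),
        ((∫ u : ℝ, (2 * a * Real.sign u) * Real.exp (-(2 * a * |u|)) *
            ‖xiGammaFactor (1 / 2 + ((t + u : ℝ) : ℂ) * I)‖ * hardyZ (t + u)) *
          (t ^ (-(7 : ℝ) / 4) * Real.exp (π * t / 4)) +
         (∫ u : ℝ, Real.exp (-(2 * a * |u|)) *
            ‖xiGammaFactor (1 / 2 + ((t + u : ℝ) : ℂ) * I)‖ * hardyZ (t + u)) *
          (t ^ (-(7 : ℝ) / 4) * Real.exp (π * t / 4) * (π / 4 - 7 / (4 * t)))) ^ 2 ≤ C * T := by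
  rintro ⟨⟨C₀, hE⟩, ⟨c₀, C, T₀, hc₀, henv⟩⟩ a ha
  have hc : 0 < 2 * a - π / 4 := by linarith
  have hπ := Real.pi_pos
  have ha0 : 0 < a := by linarith
  -- the envelope in abstract form
  set E : ℝ → ℝ := fun τ => ‖xiGammaFactor (1 / 2 + (τ : ℂ) * I)‖ with hEdef
  have hE' : ∀ τ : ℝ, E τ ≤ C₀ * (1 + |τ|) ^ ((7 : ℝ) / 4) * Real.exp (-(π * |τ| / 4)) := hE
  have hE0 : ∀ τ : ℝ, 0 ≤ E τ := fun τ => norm_nonneg _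
  have hEc : Continuous E := (continuous_xiGammaFactor_vertical (J := 1 / 2) (by norm_num)).norm
  have hmaj : ∀ t : ℝ, 1 ≤ t → ∀ u : ℝ, E (t + u) * (t ^ (-(7 : ℝ) / 4) * Real.exp (π * t / 4)) ≤
      C₀ * (2 + |u|) ^ 2 * Real.exp (-(π * u / 4)) :=
    fun t ht u => UniversalFactor.narrowUpper_envelope_majorant_of hE' hE0 ht u
  have henv' : ∀ t : ℝ, T₀ ≤ t → ∀ u : ℝ, |u| ≤ t / 2 →
      |E (t + u) * (t ^ (-(7 : ℝ) / 4) * Real.exp (π * t / 4)) - c₀ * Real.exp (-(π * u / 4))| ≤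
        C * Real.exp (-(π * u / 4)) * (1 + |u|) / t := henv
  -- sizes of the transforms
  set G₀c : ℝ := 1 + 1 / (2 * a - π / 4) ^ 2 with hG₀c
  have hG₀c0 : 0 ≤ G₀c := by positivity
  -- kernel `k₀ = e^{-2a|u|}`
  obtain ⟨C0, T0, h0⟩ := UniversalFactor.narrowUpper_kernel_bound_of (k := fun u => Real.exp (-(2 * a * |u|)))
    (G := fun ω => 1 / (((2 * a + π / 4 : ℝ) : ℂ) - ω * I) + 1 / (((2 * a - π / 4 : ℝ) : ℂ) + ω * I))
    (B := 1) (G₀ := 4 * G₀c) (G₁ := 2 / (2 * a - π / 4) ^ 2) ha (by fun_prop)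
    (fun u => by rw [abs_of_pos (Real.exp_pos _), one_mul]) hEc hE0 hmaj henv' hc₀.le
    (fun ω => UniversalFactor.narrowUpper_transform_k0 ha ω)
    (fun ω => by
      obtain ⟨h1, h2⟩ := UniversalFactor.narrowUpper_fraction_sq_le ha ω
      have h3 := (UniversalFactor.narrowUpper_norm_add_sq_le (1 / (((2 * a + π / 4 : ℝ) : ℂ) - ω * I))
        (1 / (((2 * a - π / 4 : ℝ) : ℂ) + ω * I))).1
      have : 2 * ((1 + 1 / (2 * a - π / 4) ^ 2) / (1 + ω ^ 2)) + 2 * ((1 + 1 / (2 * a - π / 4) ^ 2) / (1 + ω ^ 2)) =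
          4 * G₀c / (1 + ω ^ 2) := by rw [hG₀c]; ring
      linarith)
    (fun ω ω' => by
      obtain ⟨h1, h2⟩ := UniversalFactor.narrowUpper_fraction_lip ha ω ω'
      calc ‖1 / (((2 * a + π / 4 : ℝ) : ℂ) - ω * I) + 1 / (((2 * a - π / 4 : ℝ) : ℂ) + ω * I) -
            (1 / (((2 * a + π / 4 : ℝ) : ℂ) - ω' * I) + 1 / (((2 * a - π / 4 : ℝ) : ℂ) + ω' * I))‖
          = ‖(1 / (((2 * a + π / 4 : ℝ) : ℂ) - ω * I) - 1 / (((2 * a + π / 4 : ℝ) : ℂ) - ω' * I)) +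
              (1 / (((2 * a - π / 4 : ℝ) : ℂ) + ω * I) - 1 / (((2 * a - π / 4 : ℝ) : ℂ) + ω' * I))‖ := by
            ring_nf
        _ ≤ |ω - ω'| / (2 * a - π / 4) ^ 2 + |ω - ω'| / (2 * a - π / 4) ^ 2 := (norm_add_le _ _).trans (add_le_add h1 h2)
        _ = 2 / (2 * a - π / 4) ^ 2 * |ω - ω'| := by ring)
    (by positivity) (by positivity)
  -- kernel `k₁ = 2a sgn(u) e^{-2a|u|}`
  have hsign : Measurable Real.sign := by
    have h : Real.sign = fun r : ℝ => if r < 0 then (-1 : ℝ) else if 0 < r then 1 else 0 := by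
      funext r; rfl
    rw [h]
    exact Measurable.ite measurableSet_Iio measurable_const
      (Measurable.ite measurableSet_Ioi measurable_const measurable_const)
  obtain ⟨C1, T1, h1⟩ := UniversalFactor.narrowUpper_kernel_bound_of
    (k := fun u => 2 * a * Real.sign u * Real.exp (-(2 * a * |u|)))
    (G := fun ω => 2 * a * (1 / (((2 * a + π / 4 : ℝ) : ℂ) - ω * I) - 1 / (((2 * a - π / 4 : ℝ) : ℂ) + ω * I)))
    (B := 2 * a) (G₀ := (2 * a) ^ 2 * (4 * G₀c)) (G₁ := 2 * a * (2 / (2 * a - π / 4) ^ 2)) ha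
    ((measurable_const.mul hsign).mul (by fun_prop))
    (fun u => by
      have hs : |Real.sign u| ≤ 1 := by
        rcases Real.sign_apply_eq u with h | h | h <;> rw [h] <;> norm_num
      rw [abs_mul, abs_mul, abs_of_pos (by positivity : (0:ℝ) < 2 * a), abs_of_pos (Real.exp_pos _)]
      calc 2 * a * |Real.sign u| * Real.exp (-(2 * a * |u|)) = 2 * a * Real.exp (-(2 * a * |u|)) * |Real.sign u| := by ring
        _ ≤ 2 * a * Real.exp (-(2 * a * |u|)) * 1 := mul_le_mul_of_nonneg_left hs (by positivity)
        _ = 2 * a * Real.exp (-(2 * a * |u|)) := mul_one _)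
    hEc hE0 hmaj henv' hc₀.le
    (fun ω => UniversalFactor.narrowUpper_transform_k1 ha ω)
    (fun ω => by
      obtain ⟨h1, h2⟩ := UniversalFactor.narrowUpper_fraction_sq_le ha ω
      have h3 := (UniversalFactor.narrowUpper_norm_add_sq_le (1 / (((2 * a + π / 4 : ℝ) : ℂ) - ω * I))
        (1 / (((2 * a - π / 4 : ℝ) : ℂ) + ω * I))).2
      rw [norm_mul, mul_pow, show ‖(2 * a : ℂ)‖ = 2 * a by
        rw [show (2 * a : ℂ) = ((2 * a : ℝ) : ℂ) by push_cast; ring, Complex.norm_real, Real.norm_eq_abs,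
          abs_of_pos (by positivity : (0:ℝ) < 2 * a)]]
      have : (2 * a) ^ 2 * (2 * ((1 + 1 / (2 * a - π / 4) ^ 2) / (1 + ω ^ 2)) +
          2 * ((1 + 1 / (2 * a - π / 4) ^ 2) / (1 + ω ^ 2))) = (2 * a) ^ 2 * (4 * G₀c) / (1 + ω ^ 2) := by
        rw [hG₀c]; ring
      nlinarith [sq_nonneg (2 * a)])
    (fun ω ω' => by
      obtain ⟨h1, h2⟩ := UniversalFactor.narrowUpper_fraction_lip ha ω ω'
      have h2a : ‖(2 * a : ℂ)‖ = 2 * a := by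
        rw [show (2 * a : ℂ) = ((2 * a : ℝ) : ℂ) by push_cast; ring, Complex.norm_real, Real.norm_eq_abs,
          abs_of_pos (by positivity : (0:ℝ) < 2 * a)]
      have hD : ‖1 / (((2 * a + π / 4 : ℝ) : ℂ) - ω * I) - 1 / (((2 * a - π / 4 : ℝ) : ℂ) + ω * I) -
            (1 / (((2 * a + π / 4 : ℝ) : ℂ) - ω' * I) - 1 / (((2 * a - π / 4 : ℝ) : ℂ) + ω' * I))‖ ≤
          |ω - ω'| / (2 * a - π / 4) ^ 2 + |ω - ω'| / (2 * a - π / 4) ^ 2 := by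
        calc ‖1 / (((2 * a + π / 4 : ℝ) : ℂ) - ω * I) - 1 / (((2 * a - π / 4 : ℝ) : ℂ) + ω * I) -
              (1 / (((2 * a + π / 4 : ℝ) : ℂ) - ω' * I) - 1 / (((2 * a - π / 4 : ℝ) : ℂ) + ω' * I))‖
            = ‖(1 / (((2 * a + π / 4 : ℝ) : ℂ) - ω * I) - 1 / (((2 * a + π / 4 : ℝ) : ℂ) - ω' * I)) -
                (1 / (((2 * a - π / 4 : ℝ) : ℂ) + ω * I) - 1 / (((2 * a - π / 4 : ℝ) : ℂ) + ω' * I))‖ := by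
              ring_nf
          _ ≤ |ω - ω'| / (2 * a - π / 4) ^ 2 + |ω - ω'| / (2 * a - π / 4) ^ 2 :=
              (norm_sub_le _ _).trans (add_le_add h1 h2)
      rw [← mul_sub, norm_mul, h2a]
      calc 2 * a * ‖1 / (((2 * a + π / 4 : ℝ) : ℂ) - ω * I) - 1 / (((2 * a - π / 4 : ℝ) : ℂ) + ω * I) -
              (1 / (((2 * a + π / 4 : ℝ) : ℂ) - ω' * I) - 1 / (((2 * a - π / 4 : ℝ) : ℂ) + ω' * I))‖
          ≤ 2 * a * (|ω - ω'| / (2 * a - π / 4) ^ 2 + |ω - ω'| / (2 * a - π / 4) ^ 2) :=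
            mul_le_mul_of_nonneg_left hD (by positivity)
        _ = 2 * a * (2 / (2 * a - π / 4) ^ 2) * |ω - ω'| := by ring)
    (by positivity) (by positivity)
  -- assembly
  refine ⟨2 * C1 + 2 * C0, max (max T1 T0) 2, fun T hT => ?_⟩
  have hT1 : T1 ≤ T := ((le_max_left _ _).trans (le_max_left _ _)).trans hT
  have hT0' : T0 ≤ T := ((le_max_right _ _).trans (le_max_left _ _)).trans hT
  have hT2 : 2 ≤ T := (le_max_right _ _).trans hT
  obtain ⟨g₁, hg₁i, hg₁p, hg₁le⟩ := h1 T hT1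
  obtain ⟨g₀, hg₀i, hg₀p, hg₀le⟩ := h0 T hT0'
  rw [intervalIntegral.integral_of_le (by linarith)]
  have hptw : ∀ t ∈ Ioc T (2 * T + 1),
      ((∫ u : ℝ, (2 * a * Real.sign u) * Real.exp (-(2 * a * |u|)) *
            ‖xiGammaFactor (1 / 2 + ((t + u : ℝ) : ℂ) * I)‖ * hardyZ (t + u)) *
          (t ^ (-(7 : ℝ) / 4) * Real.exp (π * t / 4)) +
         (∫ u : ℝ, Real.exp (-(2 * a * |u|)) *
            ‖xiGammaFactor (1 / 2 + ((t + u : ℝ) : ℂ) * I)‖ * hardyZ (t + u)) *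
          (t ^ (-(7 : ℝ) / 4) * Real.exp (π * t / 4) * (π / 4 - 7 / (4 * t)))) ^ 2 ≤ 2 * g₁ t + 2 * g₀ t := by
    intro t ht
    have ht' : t ∈ Icc T (2 * T + 1) := Ioc_subset_Icc_self ht
    have ht2 : 2 ≤ t := hT2.trans ht.1.le
    have hX : ((∫ u : ℝ, (2 * a * Real.sign u) * Real.exp (-(2 * a * |u|)) *
            ‖xiGammaFactor (1 / 2 + ((t + u : ℝ) : ℂ) * I)‖ * hardyZ (t + u)) *
          (t ^ (-(7 : ℝ) / 4) * Real.exp (π * t / 4))) ^ 2 ≤ g₁ t := hg₁p t ht'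
    have hY : ((∫ u : ℝ, Real.exp (-(2 * a * |u|)) *
            ‖xiGammaFactor (1 / 2 + ((t + u : ℝ) : ℂ) * I)‖ * hardyZ (t + u)) *
          (t ^ (-(7 : ℝ) / 4) * Real.exp (π * t / 4))) ^ 2 ≤ g₀ t := hg₀p t ht'
    set X := (∫ u : ℝ, (2 * a * Real.sign u) * Real.exp (-(2 * a * |u|)) *
            ‖xiGammaFactor (1 / 2 + ((t + u : ℝ) : ℂ) * I)‖ * hardyZ (t + u)) *
          (t ^ (-(7 : ℝ) / 4) * Real.exp (π * t / 4)) with hXdef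
    set Y := (∫ u : ℝ, Real.exp (-(2 * a * |u|)) *
            ‖xiGammaFactor (1 / 2 + ((t + u : ℝ) : ℂ) * I)‖ * hardyZ (t + u)) *
          (t ^ (-(7 : ℝ) / 4) * Real.exp (π * t / 4)) with hYdef
    set q := π / 4 - 7 / (4 * t) with hq
    have hq1 : q ^ 2 ≤ 1 := by
      have h7 : 0 < 7 / (4 * t) := by positivity
      have h7' : 7 / (4 * t) ≤ 7 / 8 := by
        rw [div_le_div_iff₀ (by positivity) (by norm_num)]; linarith
      have hπ4 : π / 4 < 1 := by linarith [Real.pi_lt_four]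
      have hq' : -1 ≤ q ∧ q ≤ 1 := ⟨by rw [hq]; linarith, by rw [hq]; linarith⟩
      nlinarith [hq'.1, hq'.2]
    have hrw : (∫ u : ℝ, Real.exp (-(2 * a * |u|)) *
            ‖xiGammaFactor (1 / 2 + ((t + u : ℝ) : ℂ) * I)‖ * hardyZ (t + u)) *
          (t ^ (-(7 : ℝ) / 4) * Real.exp (π * t / 4) * (π / 4 - 7 / (4 * t))) = Y * q := by
      rw [hYdef, hq]; ring
    rw [hrw]
    have hY2 : (Y * q) ^ 2 ≤ Y ^ 2 := by
      rw [mul_pow]; nlinarith [sq_nonneg Y]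
    nlinarith [sq_nonneg (X - Y * q)]
  calc ∫ t in Ioc T (2 * T + 1),
        ((∫ u : ℝ, (2 * a * Real.sign u) * Real.exp (-(2 * a * |u|)) *
            ‖xiGammaFactor (1 / 2 + ((t + u : ℝ) : ℂ) * I)‖ * hardyZ (t + u)) *
          (t ^ (-(7 : ℝ) / 4) * Real.exp (π * t / 4)) +
         (∫ u : ℝ, Real.exp (-(2 * a * |u|)) *
            ‖xiGammaFactor (1 / 2 + ((t + u : ℝ) : ℂ) * I)‖ * hardyZ (t + u)) *
          (t ^ (-(7 : ℝ) / 4) * Real.exp (π * t / 4) * (π / 4 - 7 / (4 * t)))) ^ 2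
      ≤ ∫ t in Ioc T (2 * T + 1), (2 * g₁ t + 2 * g₀ t) :=
        integral_mono_of_nonneg (Eventually.of_forall fun t => sq_nonneg _)
          ((hg₁i.const_mul 2).add (hg₀i.const_mul 2)) (ae_restrict_of_forall_mem measurableSet_Ioc hptw)
    _ = 2 * (∫ t in Ioc T (2 * T + 1), g₁ t) + 2 * ∫ t in Ioc T (2 * T + 1), g₀ t := by
        rw [integral_add (hg₁i.const_mul 2) (hg₀i.const_mul 2), MeasureTheory.integral_const_mul,
          MeasureTheory.integral_const_mul]
    _ ≤ (2 * C1 + 2 * C0) * T := by nlinarith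

end Summit.RiemannHypothesis.RiemannHypothesis.Theorems
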